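import Literature.Computability.AlgebraicComplexity.TavenasHomogeneousProofs
import Literature.Computability.AlgebraicComplexity.ArithCircuitProofs
import HarnessLib

/-!
# Raz's universal circuit-graph in normal homogeneous form, and the degree-`(2r-1)` polynomial
# mapping `Γ` whose image contains every degree-`r` form of small circuit complexity

R. Raz, *Elusive functions and lower bounds for arithmetic circuits*, Theory of Computing 6
(2010) 135–177, §2.1 (Prop. 2.3, normal-homogeneous form), §2.4 (Prop. 2.8, the universal
circuit-graph), §3.2 (Prop. 3.1, Prop. 3.2: the polynomial mapping `Γ_G : F^s → F^m` of a
circuit-graph `G` has degree `2r - 1`; Prop. 3.3). This file proves the one consequence of these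
propositions that the route to lower bounds (§3.4, Cor. 3.8/3.9) uses, in the tree's model of
arithmetic circuits (`complexity`, `ArithCircuit.lean`):

* `RazUniversal.out` — the generic output polynomial `OUT ∈ (R[Y])[Z]` of a universal layered
  circuit-graph with edge labels `Y` (Raz's levels `1, …, 2r`: leaves `z_t`; for every degree
  `d ≤ r` and type `1 ≤ j < d` a supply of `N` product gates, each multiplying a fresh
  `Y`-weighted sum of all level-`j` nodes with a fresh `Y`-weighted sum of all level-`(d-j)`
  nodes; the output gate is a `Y`-weighted sum of all level-`r` nodes), `RazUniversal.base` its
  nodes, and `RazUniversal.uCoeff e = coeff_e OUT ∈ R[Y]`, the coordinates of Raz's `Γ_G`;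
* `RazUniversal.totalDegree_uCoeff_le` — **Prop. 3.2**: every coordinate of `Γ_G` has degree
  `≤ 2r - 1` in the labels (product gates of syntactic degree `d` carry label-degree `2d - 2`,
  sum gates `2d - 1`);
* `RazUniversal.exists_labels_of_homCircuit` — **Props. 2.8 and 3.1** for homogeneous circuit
  certificates (`DepthReduction.HomCircuit`, `GateQuotients.lean`): every node of formal degree
  `d ∈ [1, r]` of a homogeneous circuit on a node type that injects into `Fin N` is, for a
  suitable labelling `y`, the value of a level-`d` sum gate of the universal graph (the
  embedding "label by `0` every edge to or from a node that is not in `G_Ψ'`", p. 155);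
* `RazUniversal.exists_labels_of_complexity_le` — **Prop. 3.3 (2)** in the form used by
  Prop. 3.7: a HOMOGENEOUS polynomial `g` of degree `r ≥ 1` with `complexity g ≤ s` is
  `OUT(y)` for some labelling `y`, as soon as `N ≥ 4 s (r+1)²` (homogenisation of the
  straight-line program, `DepthReduction.SLP.homogenize`, Prop. 2.3 / Tavenas Prop. 2, then the
  embedding); hence its coefficient vector is `Γ(y)` (`eval_uCoeff_eq_coeff`);
* `RazUniversal.card_lab_le` — the number of labels is polynomial in `#σ`, `r`, `N`
  (Raz: `s = S(G) ≤ Size(G) = O(s'² r⁸)`; here `≤ 2 (r+1)² N (#σ + r N) + (#σ + r N)`, no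
  attempt at Raz's constants).

## Rendering and deviations from the printed construction

* Raz first puts a given circuit into normal-homogeneous form (Prop. 2.3: homogenise, remove
  degree-`0` nodes, alternate, fan-in-`2` products, out-degree-`1` sums) and then embeds its
  graph into the universal graph level by level. Here the homogenisation is the tree's
  `SLP.homogenize` (every line of a straight-line program split into its homogeneous
  components, products by the Cauchy formula), and the remaining normalisation steps are
  absorbed into the embedding `exists_labels_of_homCircuit`: a node of formal degree `0` is a
  constant (`HomCircuit.isHomogeneous_val`) and is folded into the weights of its parent
  (Raz: "remove every node of syntactic-degree 0"), a sum node becomes a weight vector on the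
  level of its degree (Raz: sums of sums are merged, "the children of every sum-gate in
  Level-(2i) are all the nodes in Level-(2i − 1)"), and a product node of degree `d = j + (d-j)`
  with both factors of positive degree occupies its private slot `(d, j, emb ν)` (Raz: "just
  pick arbitrary gates (in the right levels) that were still not used").
* The universal graph is generous: every level carries slots of every type `j < r` and all `N`
  slots, and unused slots simply receive arbitrary (here: zero) labels; only polynomial size
  matters downstream (`card_lab_le`).
* Coefficients: any commutative semiring `R` (Raz: a field); variables: any finite type `σ`
  (Raz: `z₁, …, zₙ`).

## References

* R. Raz, *Elusive functions and lower bounds for arithmetic circuits*, Theory of Computing 6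
  (2010) 135–177: Def. 2.1, Def. 2.2, Prop. 2.3 (pp. 148–150), Prop. 2.8 (pp. 154–155),
  §3.1–3.2 (Props. 3.1–3.3, pp. 156–159).
* S. Tavenas, *Improved bounds for reduction to depth 4 and depth 3*, Inform. Comput. 240
  (2015) 2–11, Prop. 2 (homogenisation; the tree's `SLP.homogenize`).
* P. Bürgisser, *Completeness and Reduction in Algebraic Complexity Theory*, Springer 2000,
  Def. 2.1 (the tree's `complexity`).
-/

noncomputable section

open MvPolynomial

namespace Literature.Computability.AlgebraicComplexity

namespace RazUniversal

universe u v w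

variable {R : Type u} [CommSemiring R]

/-! ### The universal layered circuit-graph: indices, labels, generic node polynomials -/

section Defs

variable (σ : Type v) (r N : ℕ)

/-- Indices of the nodes feeding the sum gates of one level of the universal circuit-graph
(Raz 2010, proof of Prop. 2.8): a leaf `z_t` (`Sum.inl t`, present at level `1` only) or the
product slot number `k < N` of type `j` (`Sum.inr (j, k)`; at level `d` it multiplies a sum of
level-`j` nodes with a sum of level-`(d - j)` nodes, and is void unless `1 ≤ j < d`).
[cite: Raz2010, Prop. 2.8 (pp. 154–155)] -/
abbrev BIdx : Type v := σ ⊕ (Fin r × Fin N)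

/-- The edge labels `y₁, …, y_s` of the universal circuit-graph (Raz 2010, §3.2: the labels of
the edges reaching sum gates; edges into product gates are labelled `1`): `Sum.inl (d, j, k, side,
b)` labels the edge from node `b` into the left (`side = false`) or right (`side = true`) sum
gate feeding the product slot `(j, k)` of level `d`, and `Sum.inr b` labels the edge from the
level-`r` node `b` into the output gate. [cite: Raz2010, §3.2 (p. 157)] -/
abbrev Lab : Type v := (Fin (r + 1) × Fin r × Fin N × Bool × BIdx σ r N) ⊕ BIdx σ r N

variable {σ r N} [Fintype σ]

/-- The generic polynomial `g̃_v ∈ (R[Y])[Z]` computed at the node `b` of level `d` of the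
universal circuit-graph when the edge labels are kept as variables `Y` (Raz 2010, proof of
Prop. 3.2: "we can think of `g₁, …, gₙ` as polynomials in the input variables `z₁, …, zₙ`, with
coefficients that are polynomials in the input variables `y₁, …, y_s`"): a leaf is `z_t` at level
`1` (and void elsewhere); the product slot `(j, k)` of level `d`, `1 ≤ j < d`, is
`(∑_b Y_{(d,j,k,0,b)} · g̃_{j,b}) · (∑_b Y_{(d,j,k,1,b)} · g̃_{d-j,b})`.
[cite: Raz2010, Prop. 2.8 (p. 154), Prop. 3.2 (p. 157)] -/
def base : Fin (r + 1) → BIdx σ r N → MvPolynomial σ (MvPolynomial (Lab σ r N) R)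
  | d, Sum.inl t => if (d : ℕ) = 1 then X t else 0
  | d, Sum.inr (j, k) =>
      if h : 1 ≤ (j : ℕ) ∧ (j : ℕ) < (d : ℕ) then
        (∑ b : BIdx σ r N, C (X (Sum.inl (d, j, k, false, b))) * base (Fin.castSucc j) b) *
          (∑ b : BIdx σ r N, C (X (Sum.inl (d, j, k, true, b))) *
            base ⟨(d : ℕ) - j, by have := d.isLt; omega⟩ b)
      else 0
termination_by d => (d : ℕ)
decreasing_by
  all_goals
    try simp only [Fin.val_castSucc]
    omega

variable (R σ r N)

/-- The generic output `OUT = ∑_b Y_b · g̃_{r,b} ∈ (R[Y])[Z]` of the universal circuit-graph: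
the output gate is a sum gate over all level-`r` nodes (Raz 2010, Prop. 2.8: "the nodes in
Level-(2r) are the output-gates"). [cite: Raz2010, Prop. 2.8 (p. 154), §3.2 (p. 157)] -/
def out : MvPolynomial σ (MvPolynomial (Lab σ r N) R) :=
  ∑ b : BIdx σ r N, C (X (Sum.inr b)) * base (Fin.last r) b

/-- **Raz's polynomial mapping `Γ_G`**, coordinate of the monomial `e`: the coefficient of `z^e`
in `OUT`, a polynomial in the labels `Y` (Raz 2010, §3.2: "`Γ_G(y₁, …, y_s) = H((g₁, …, gₙ))` …
the functions `(Γ_G)₁, …, (Γ_G)_m` are polynomials in `F[y₁, …, y_s]`"; here for a single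
output and for every exponent `e`, the degree-`r` ones being Raz's coordinates).
[cite: Raz2010, §3.2 (p. 157)] -/
def uCoeff (e : σ →₀ ℕ) : MvPolynomial (Lab σ r N) R :=
  coeff e (out R σ r N)

end Defs

/-! ### Prop. 3.2: the label-degree of the coefficients -/

section Degree

variable {σ : Type v} {τ : Type w}

/-- "Every coefficient of `P ∈ (R[Y])[Z]` is a polynomial of degree `≤ D` in the labels `Y`"
(the quantity tracked in the proof of Raz 2010, Prop. 3.2). [cite: Raz2010, Prop. 3.2 (p. 158)] -/
def LabDegLE (P : MvPolynomial σ (MvPolynomial τ R)) (D : ℕ) : Prop :=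
  ∀ e, (coeff e P).totalDegree ≤ D

/-- `0` has label-degree `≤ D`. [folklore] -/
theorem labDegLE_zero (D : ℕ) : LabDegLE (0 : MvPolynomial σ (MvPolynomial τ R)) D :=
  fun e => by simp

/-- A variable `z_t` has label-degree `≤ D` (its coefficients are `0` and `1`). [folklore] -/
theorem labDegLE_X (t : σ) (D : ℕ) : LabDegLE (X t : MvPolynomial σ (MvPolynomial τ R)) D := by
  intro e
  classical
  rw [coeff_X]
  split_ifs <;> simp

/-- Monotonicity in the bound. [folklore] -/
theorem LabDegLE.mono {P : MvPolynomial σ (MvPolynomial τ R)} {D D' : ℕ} (h : LabDegLE P D)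
    (hD : D ≤ D') : LabDegLE P D' :=
  fun e => (h e).trans hD

/-- Sums preserve label-degree bounds. [folklore] -/
theorem LabDegLE.add {P Q : MvPolynomial σ (MvPolynomial τ R)} {D : ℕ} (hP : LabDegLE P D)
    (hQ : LabDegLE Q D) : LabDegLE (P + Q) D :=
  fun e => by rw [coeff_add]; exact (totalDegree_add _ _).trans (max_le (hP e) (hQ e))

/-- Finite sums preserve label-degree bounds. [folklore] -/
theorem LabDegLE.sum {ι : Type*} (s : Finset ι) {P : ι → MvPolynomial σ (MvPolynomial τ R)}
    {D : ℕ} (h : ∀ i ∈ s, LabDegLE (P i) D) : LabDegLE (∑ i ∈ s, P i) D := by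
  intro e
  rw [coeff_sum]
  exact totalDegree_finsetSum_le fun i hi => h i hi e

/-- Products add label-degree bounds (proof of Raz 2010, Prop. 3.2, product gates: "the
coefficients in the polynomial `g_v` are (homogenous) polynomials of degree
`2r_{v₁} - 1 + 2r_{v₂} - 1`"). [cite: Raz2010, Prop. 3.2 (p. 158)] -/
theorem LabDegLE.mul {P Q : MvPolynomial σ (MvPolynomial τ R)} {D₁ D₂ : ℕ} (hP : LabDegLE P D₁)
    (hQ : LabDegLE Q D₂) : LabDegLE (P * Q) (D₁ + D₂) := by
  intro e
  classical
  rw [coeff_mul]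
  refine totalDegree_finsetSum_le fun p _ => ?_
  exact (totalDegree_mul _ _).trans (Nat.add_le_add (hP p.1) (hQ p.2))

/-- Multiplying by a label raises the bound by one (proof of Raz 2010, Prop. 3.2, sum gates:
"since the edge `(u, v)` is labelled by an element of `{y₁, …, y_s}`, the coefficients in the
polynomial `g_v` are (homogenous) polynomials of degree `2r_v - 1`").
[cite: Raz2010, Prop. 3.2 (p. 158)] -/
theorem LabDegLE.C_X_mul {P : MvPolynomial σ (MvPolynomial τ R)} {D : ℕ} (hP : LabDegLE P D)
    (l : τ) : LabDegLE (C (X l) * P) (D + 1) := by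
  intro e
  rw [coeff_C_mul]
  refine (totalDegree_mul _ _).trans ?_
  rw [Nat.add_comm]
  exact Nat.add_le_add (hP e) (DepthReduction.totalDegree_X_le (k := R) l)

variable {r N : ℕ} [Fintype σ]

/-- **Raz 2010, proof of Prop. 3.2** (product gates): the node `b` of level `d` of the universal
circuit-graph computes a polynomial whose coefficients have degree `≤ 2d - 2` in the labels.
[cite: Raz2010, Prop. 3.2 (p. 158)] -/
theorem labDegLE_base : ∀ (n : ℕ) (d : Fin (r + 1)), (d : ℕ) = n →
    ∀ b : BIdx σ r N, LabDegLE (base (R := R) d b) (2 * n - 2) := by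
  intro n
  induction n using Nat.strong_induction_on with
  | _ n ih =>
    rintro d rfl b
    rcases b with t | ⟨j, k⟩
    · rw [base]
      split_ifs
      · exact labDegLE_X t _
      · exact labDegLE_zero _
    · rw [base]
      split_ifs with h
      · have h1 : LabDegLE (∑ b : BIdx σ r N,
            C (X (Sum.inl (d, j, k, false, b))) * base (R := R) (Fin.castSucc j) b)
            (2 * (j : ℕ) - 2 + 1) :=
          LabDegLE.sum _ fun b _ =>
            LabDegLE.C_X_mul (ih (j : ℕ) h.2 (Fin.castSucc j) rfl b) _
        have h2 : LabDegLE (∑ b : BIdx σ r N,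
            C (X (Sum.inl (d, j, k, true, b))) *
              base (R := R) ⟨(d : ℕ) - j, by have := d.isLt; omega⟩ b)
            (2 * ((d : ℕ) - j) - 2 + 1) :=
          LabDegLE.sum _ fun b _ =>
            LabDegLE.C_X_mul (ih ((d : ℕ) - j) (by omega)
              ⟨(d : ℕ) - j, by have := d.isLt; omega⟩ rfl b) _
        exact (h1.mul h2).mono (by omega)
      · exact labDegLE_zero _

/-- **Raz 2010, Prop. 3.2**: `OUT` has coefficients of degree `≤ 2r - 1` in the labels, i.e.
"the mapping `Γ_G : F^s → F^m` … is a (homogenous) polynomial mapping of degree `2r - 1`"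
(homogeneity is not recorded). [cite: Raz2010, Prop. 3.2 (p. 157)] -/
theorem labDegLE_out : LabDegLE (out R σ r N) (2 * r - 1) := by
  unfold out
  refine LabDegLE.sum _ fun b _ => ?_
  rcases Nat.eq_zero_or_pos r with hr | hr
  · -- `r = 0`: level `0` carries no node at all
    subst hr
    have hb : base (R := R) (Fin.last 0) b = 0 := by
      rcases b with t | ⟨j, k⟩
      · rw [base]; simp
      · exact j.elim0
    rw [hb, mul_zero]
    exact labDegLE_zero _
  · exact (LabDegLE.C_X_mul (labDegLE_base (R := R) r (Fin.last r) rfl b) _).mono (by omega)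

/-- **Raz 2010, Prop. 3.2**, coordinatewise: `deg (Γ_G)_e ≤ 2r - 1` for every monomial `e`.
[cite: Raz2010, Prop. 3.2 (p. 157)] -/
theorem totalDegree_uCoeff_le (e : σ →₀ ℕ) : (uCoeff R σ r N e).totalDegree ≤ 2 * r - 1 :=
  labDegLE_out e

end Degree


/-! ### Evaluating the universal circuit-graph at a labelling -/

section Eval

variable {σ : Type v} {r N : ℕ} [Fintype σ]

/-- The polynomial `g_v ∈ R[Z]` computed at the node `b` of level `d` when the edges carry the
labels `y` (Raz 2010, §3.2: the circuit `Φ` with circuit-graph `G` and labels `y₁, …, y_s`).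
[cite: Raz2010, §3.2 (p. 157)] -/
def baseVal (y : Lab σ r N → R) (d : Fin (r + 1)) (b : BIdx σ r N) : MvPolynomial σ R :=
  MvPolynomial.map (eval y) (base d b)

/-- The output `OUT(y) ∈ R[Z]` of the universal circuit with labels `y`.
[cite: Raz2010, §3.2 (p. 157)] -/
def outVal (y : Lab σ r N → R) : MvPolynomial σ R :=
  MvPolynomial.map (eval y) (out R σ r N)

/-- A leaf computes `z_t` at level `1` and nothing elsewhere. [cite: Raz2010, Prop. 2.8 (p. 154)] -/
theorem baseVal_inl (y : Lab σ r N → R) (d : Fin (r + 1)) (t : σ) :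
    baseVal y d (Sum.inl t) = if (d : ℕ) = 1 then X t else 0 := by
  unfold baseVal
  rw [base]
  split_ifs <;> simp

/-- A product slot of type `j` at level `d`, `1 ≤ j < d`, computes the product of the two
`y`-weighted sums of the nodes of levels `j` and `d - j`.
[cite: Raz2010, Prop. 2.8 (pp. 154–155)] -/
theorem baseVal_inr (y : Lab σ r N → R) (d : Fin (r + 1)) (j : Fin r) (k : Fin N)
    (h : 1 ≤ (j : ℕ) ∧ (j : ℕ) < (d : ℕ)) :
    baseVal y d (Sum.inr (j, k)) =
      (∑ b : BIdx σ r N, y (Sum.inl (d, j, k, false, b)) • baseVal y (Fin.castSucc j) b) *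
        (∑ b : BIdx σ r N, y (Sum.inl (d, j, k, true, b)) •
          baseVal y ⟨(d : ℕ) - j, by have := d.isLt; omega⟩ b) := by
  unfold baseVal
  rw [base, dif_pos h, map_mul, map_sum, map_sum]
  simp only [map_mul, map_C, eval_X, smul_eq_C_mul]

/-- A void product slot computes `0`. [cite: Raz2010, Prop. 2.8 (pp. 154–155)] -/
theorem baseVal_inr_of_not (y : Lab σ r N → R) (d : Fin (r + 1)) (j : Fin r) (k : Fin N)
    (h : ¬ (1 ≤ (j : ℕ) ∧ (j : ℕ) < (d : ℕ))) : baseVal y d (Sum.inr (j, k)) = 0 := by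
  unfold baseVal
  rw [base, dif_neg h, map_zero]

/-- The output gate is the `y`-weighted sum of the level-`r` nodes.
[cite: Raz2010, Prop. 2.8 (p. 154)] -/
theorem outVal_eq (y : Lab σ r N → R) :
    outVal y = ∑ b : BIdx σ r N, y (Sum.inr b) • baseVal y (Fin.last r) b := by
  unfold outVal out baseVal
  rw [map_sum]
  simp only [map_mul, map_C, eval_X, smul_eq_C_mul]

/-- **`Γ_G(y) = H(OUT(y))`** (Raz 2010, definition of `Γ_G`, §3.2): the coefficient of `z^e` in
the output of the labelled circuit is the value at `y` of the coordinate polynomial `(Γ_G)_e`.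
[cite: Raz2010, §3.2 (p. 157)] -/
theorem coeff_outVal (y : Lab σ r N → R) (e : σ →₀ ℕ) :
    coeff e (outVal y) = eval y (uCoeff R σ r N e) := by
  unfold outVal uCoeff
  rw [coeff_map]

/-- With all labels `0` the circuit outputs `0`. [folklore] -/
theorem outVal_zero : outVal (r := r) (N := N) (fun _ : Lab σ r N => (0 : R)) = 0 := by
  rw [outVal_eq]
  simp

end Eval

/-! ### Props. 2.8 and 3.1: embedding a homogeneous circuit into the universal circuit-graph -/

section Embedding

open DepthReduction

variable {σ : Type v} {ι : Type w}
variable (H : HomCircuit R σ ι) (r : ℕ) {N : ℕ} (emb : ι → Fin N)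

/-- The scalar computed by a node of formal degree `0` (Raz 2010, proof of Prop. 2.3: a node of
syntactic degree `0` "just computes a field element `α`"). [cite: Raz2010, Prop. 2.3 (p. 150)] -/
def cst (ν : ι) : R :=
  coeff 0 (H.val ν)

/-- A node of formal degree `0` computes the constant `cst ν`. [cite: Raz2010, Prop. 2.3 (p. 150)] -/
theorem val_eq_C_cst {ν : ι} (h : H.deg ν = 0) : H.val ν = C (cst H ν) := by
  have h0 : (H.val ν).totalDegree = 0 :=
    Nat.eq_zero_of_le_zero (h ▸ (H.isHomogeneous_val ν).totalDegree_le)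
  exact totalDegree_eq_zero_iff_eq_C.1 h0

variable [DecidableEq σ]

/-- Fuel-bounded recursion for the weight vectors `coef`. [cite: Raz2010, Prop. 2.8 (p. 155)] -/
def coefFuel : ℕ → ι → BIdx σ r N → R
  | 0, _ => 0
  | n + 1, ν =>
    match H.kind ν with
    | .var t => Pi.single (Sum.inl t) 1
    | .const _ => 0
    | .sum args => (args.map fun a => a.1 • coefFuel n a.2).sum
    | .prod a c =>
        if H.deg a = 0 then cst H a • coefFuel n c
        else if H.deg c = 0 then cst H c • coefFuel n a
        else if h : H.deg a < r then Pi.single (Sum.inr (⟨H.deg a, h⟩, emb ν)) 1 else 0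

/-- **The weight vector of a node** (the embedding of Raz 2010, proof of Prop. 2.8, p. 155,
combined with the normalisation steps of Prop. 2.3): the node `ν` of formal degree `d` of the
homogeneous circuit `H` is the sum gate `∑_b coef ν b · (node b of level d)` of the universal
circuit-graph — a variable is its leaf; a sum node is the weighted sum of the weight vectors of
its arguments (Raz: sums of sums are merged); a product by a degree-`0` node is a rescaling
(Raz: degree-`0` nodes are removed); a product `a · c` of two nodes of positive degree is the
indicator of its private slot `(deg a, emb ν)` (Raz: "pick arbitrary gates (in the right levels)
that were still not used"). [cite: Raz2010, Prop. 2.8 (p. 155), Prop. 2.3 (p. 150)] -/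
def coef (ν : ι) : BIdx σ r N → R :=
  coefFuel H r emb (H.rank ν + 1) ν

/-- The fuel-bounded recursion stabilises as soon as the fuel exceeds the rank. [folklore] -/
theorem coefFuel_eq : ∀ n ν, H.rank ν < n → coefFuel H r emb n ν = coef H r emb ν := by
  intro n
  induction n using Nat.strong_induction_on with
  | _ n ih =>
    intro ν hν
    obtain ⟨n, rfl⟩ : ∃ n', n = n' + 1 := ⟨n - 1, by omega⟩
    unfold coef
    simp only [coefFuel]
    cases hkind : H.kind ν with
    | var j => rfl
    | const c => rfl
    | sum args =>
      simp only
      congr 1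
      apply List.map_congr_left
      intro a ha
      have hr := ((H.wf_sum ν args hkind).1 a ha).1
      rw [ih n (Nat.lt_succ_self n) a.2 (by omega), ih (H.rank ν) hν a.2 hr]
    | prod a c =>
      simp only
      obtain ⟨hra, hrc, -, -⟩ := H.wf_prod ν a c hkind
      rw [ih n (Nat.lt_succ_self n) c (by omega), ih (H.rank ν) hν c hrc,
        ih n (Nat.lt_succ_self n) a (by omega), ih (H.rank ν) hν a hra]

/-- Weight vector of a variable leaf. [cite: Raz2010, Prop. 2.8 (p. 155)] -/
theorem coef_var {ν : ι} {t : σ} (h : H.kind ν = .var t) :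
    coef H r emb ν = Pi.single (Sum.inl t) 1 := by
  rw [coef, coefFuel, h]

/-- Weight vector of a sum node. [cite: Raz2010, Prop. 2.8 (p. 155)] -/
theorem coef_sum {ν : ι} {args : List (R × ι)} (h : H.kind ν = .sum args) :
    coef H r emb ν = (args.map fun a => a.1 • coef H r emb a.2).sum := by
  conv_lhs => rw [coef, coefFuel, h]
  simp only
  congr 1
  apply List.map_congr_left
  intro a ha
  rw [coefFuel_eq H r emb _ _ ((H.wf_sum ν args h).1 a ha).1]

/-- Weight vector of a product by a left factor of degree `0`. [cite: Raz2010, Prop. 2.3 (p. 150)] -/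
theorem coef_prod_of_left {ν a c : ι} (h : H.kind ν = .prod a c) (ha : H.deg a = 0) :
    coef H r emb ν = cst H a • coef H r emb c := by
  conv_lhs => rw [coef, coefFuel, h]
  simp only [ha, if_true]
  rw [coefFuel_eq H r emb _ _ (H.wf_prod ν a c h).2.1]

/-- Weight vector of a product by a right factor of degree `0`. [cite: Raz2010, Prop. 2.3 (p. 150)] -/
theorem coef_prod_of_right {ν a c : ι} (h : H.kind ν = .prod a c) (ha : H.deg a ≠ 0)
    (hc : H.deg c = 0) : coef H r emb ν = cst H c • coef H r emb a := by
  conv_lhs => rw [coef, coefFuel, h]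
  simp only [ha, if_false, hc, if_true]
  rw [coefFuel_eq H r emb _ _ (H.wf_prod ν a c h).1]

/-- Weight vector of a genuine product node: the indicator of its slot.
[cite: Raz2010, Prop. 2.8 (p. 155)] -/
theorem coef_prod {ν a c : ι} (h : H.kind ν = .prod a c) (ha : H.deg a ≠ 0) (hc : H.deg c ≠ 0)
    (hlt : H.deg a < r) :
    coef H r emb ν = Pi.single (Sum.inr (⟨H.deg a, hlt⟩, emb ν)) 1 := by
  conv_lhs => rw [coef, coefFuel, h]
  simp only [ha, if_false, hc, hlt, dif_pos]

/-- The labels of the two sum gates feeding the slot occupied by the node `ν` (if it is a genuine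
product node of degree `d` and type `j`): the weight vectors of its two factors; all other
edges into slots are labelled `0` (Raz 2010, proof of Prop. 2.8: "we just label by `0` every
edge to or from a node that is not in `G_Ψ'`"). [cite: Raz2010, Prop. 2.8 (p. 155)] -/
def slotLabelAt (ν : ι) (d : Fin (r + 1)) (j : Fin r) (side : Bool) (b : BIdx σ r N) : R :=
  match H.kind ν with
  | .prod a c =>
      if H.deg ν = (d : ℕ) ∧ H.deg a = (j : ℕ) ∧ H.deg a ≠ 0 ∧ H.deg c ≠ 0 then
        (if side then coef H r emb c b else coef H r emb a b)
      else 0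
  | _ => 0

open Classical in
/-- The labelling of the edges into product slots induced by the circuit `H`.
[cite: Raz2010, Prop. 2.8 (p. 155)] -/
def slotLabel : Fin (r + 1) × Fin r × Fin N × Bool × BIdx σ r N → R
  | (d, j, k, side, b) => if h : ∃ ν, emb ν = k then slotLabelAt H r emb h.choose d j side b else 0

/-- The full labelling induced by `H` and an output node `ν₀`: slots as above, and the output
gate weighted by the weight vector of `ν₀`. [cite: Raz2010, Prop. 2.8 (p. 155)] -/
def labels (ν₀ : ι) : Lab σ r N → R :=
  Sum.elim (slotLabel H r emb) (coef H r emb ν₀)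

variable {H r emb}

/-- The slot of a genuine product node carries the weight vectors of its factors.
[cite: Raz2010, Prop. 2.8 (p. 155)] -/
theorem slotLabel_emb (hemb : Function.Injective emb) {ν a c : ι} (h : H.kind ν = .prod a c)
    (ha : H.deg a ≠ 0) (hc : H.deg c ≠ 0) {d : Fin (r + 1)} {j : Fin r} (hd : H.deg ν = (d : ℕ))
    (hj : H.deg a = (j : ℕ)) (side : Bool) (b : BIdx σ r N) :
    slotLabel H r emb (d, j, emb ν, side, b) = if side then coef H r emb c b else coef H r emb a b := by
  have hex : ∃ ν', emb ν' = emb ν := ⟨ν, rfl⟩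
  have hch : hex.choose = ν := hemb hex.choose_spec
  unfold slotLabel
  simp only [dif_pos hex]
  rw [hch, slotLabelAt, h]
  have hj0 : (j : ℕ) ≠ 0 := hj ▸ ha
  simp [hd, hj, hj0, hc]

/-- `∑_b δ_{i b} · v_b = v_i`. [folklore] -/
theorem sum_single_one_smul {α : Type*} [Fintype α] [DecidableEq α] {M : Type*} [AddCommMonoid M]
    [Module R M] (i : α) (v : α → M) : ∑ b, (Pi.single i (1 : R) : α → R) b • v b = v i := by
  rw [Finset.sum_eq_single i]
  · rw [Pi.single_eq_same, one_smul]
  · intro b _ hb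
    rw [Pi.single_eq_of_ne hb, zero_smul]
  · intro hi
    exact absurd (Finset.mem_univ i) hi

/-- Weighted list sums of weight vectors act linearly: `∑_b (∑_a c_a φ_a)(b) v_b = ∑_a c_a ∑_b φ_a(b) v_b`.
[folklore] -/
theorem sum_listSum_smul {α : Type*} [Fintype α] {M : Type*} [AddCommMonoid M] [Module R M]
    (l : List (R × ι)) (φ : ι → α → R) (v : α → M) :
    ∑ b, ((l.map fun a => a.1 • φ a.2).sum b) • v b =
      (l.map fun a => a.1 • ∑ b, φ a.2 b • v b).sum := by
  induction l with
  | nil => simp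
  | cons a l ih =>
    simp only [List.map_cons, List.sum_cons, Pi.add_apply, Pi.smul_apply, smul_eq_mul, add_smul,
      Finset.sum_add_distrib, ih, mul_smul, Finset.smul_sum]

variable [Fintype σ]

/-- **Raz 2010, Props. 2.8 and 3.1 (embedding into the universal circuit-graph)**: with the
labelling induced by `H`, every node `ν` of formal degree `d ∈ [1, r]` computes
`∑_b coef ν b · g_{d,b}(y)`, i.e. it is the sum gate of level `d` with weights `coef ν`.
Rank induction (the circuit `H` is processed bottom-up, as in the proof of Prop. 2.8).
[cite: Raz2010, Prop. 2.8 (pp. 154–155), Prop. 3.1 (p. 157)] -/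
theorem val_eq_sum_coef_smul_baseVal (hemb : Function.Injective emb) (ν₀ : ι) :
    ∀ (n : ℕ) (ν : ι), H.rank ν = n → 1 ≤ H.deg ν → ∀ D : Fin (r + 1), (D : ℕ) = H.deg ν →
      H.val ν = ∑ b, coef H r emb ν b • baseVal (labels H r emb ν₀) D b := by
  intro n
  induction n using Nat.strong_induction_on with
  | _ n ih =>
    intro ν hn h1 D hD
    cases hkind : H.kind ν with
    | var t =>
      obtain ⟨hv, hdeg⟩ := H.wf_var ν t hkind
      rw [coef_var H r emb hkind, sum_single_one_smul, baseVal_inl, if_pos (by omega), hv]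
    | const c =>
      obtain ⟨-, hdeg⟩ := H.wf_const ν c hkind
      omega
    | sum args =>
      obtain ⟨hargs, hv⟩ := H.wf_sum ν args hkind
      rw [coef_sum H r emb hkind, sum_listSum_smul, hv]
      congr 1
      apply List.map_congr_left
      intro a ha
      obtain ⟨hra, hda⟩ := hargs a ha
      rw [ih (H.rank a.2) (hn ▸ hra) a.2 rfl (by omega) D (by omega)]
    | prod a c =>
      obtain ⟨hra, hrc, hdeg, hv⟩ := H.wf_prod ν a c hkind
      by_cases ha : H.deg a = 0
      · rw [coef_prod_of_left H r emb hkind ha, hv, val_eq_C_cst H ha,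
          ih (H.rank c) (hn ▸ hrc) c rfl (by omega) D (by omega), ← smul_eq_C_mul,
          Finset.smul_sum]
        refine Finset.sum_congr rfl fun b _ => ?_
        rw [Pi.smul_apply, smul_eq_mul, mul_smul]
      by_cases hc : H.deg c = 0
      · rw [coef_prod_of_right H r emb hkind ha hc, hv, val_eq_C_cst H hc,
          ih (H.rank a) (hn ▸ hra) a rfl (by omega) D (by omega), mul_comm, ← smul_eq_C_mul,
          Finset.smul_sum]
        refine Finset.sum_congr rfl fun b _ => ?_
        rw [Pi.smul_apply, smul_eq_mul, mul_smul]
      · have hlt : H.deg a < r := by have := D.isLt; omega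
        rw [coef_prod H r emb hkind ha hc hlt, sum_single_one_smul,
          baseVal_inr _ _ _ _ ⟨Nat.one_le_iff_ne_zero.2 ha, by simp only; omega⟩]
        have hL : ∀ b, labels H r emb ν₀ (Sum.inl (D, ⟨H.deg a, hlt⟩, emb ν, false, b)) =
            coef H r emb a b := fun b =>
          slotLabel_emb hemb hkind ha hc hD.symm rfl false b
        have hR : ∀ b, labels H r emb ν₀ (Sum.inl (D, ⟨H.deg a, hlt⟩, emb ν, true, b)) =
            coef H r emb c b := fun b =>
          slotLabel_emb hemb hkind ha hc hD.symm rfl true b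
        simp only [hL, hR]
        rw [← ih (H.rank a) (hn ▸ hra) a rfl (by omega) (Fin.castSucc ⟨H.deg a, hlt⟩) rfl,
          ← ih (H.rank c) (hn ▸ hrc) c rfl (by omega) ⟨(D : ℕ) - H.deg a, _⟩ (by simp only; omega),
          hv]

/-- **Raz 2010, Prop. 3.1 (one direction), via Prop. 2.8**: a node `ν₀` of formal degree `r ≥ 1`
of a homogeneous circuit whose node type injects into `Fin N` is the output of the universal
circuit-graph for the induced labelling: `OUT(labels ν₀) = val ν₀`.
[cite: Raz2010, Prop. 2.8 (pp. 154–155), Prop. 3.1 (p. 157)] -/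
theorem outVal_labels (hemb : Function.Injective emb) {ν₀ : ι} (hr : 1 ≤ r) (h : H.deg ν₀ = r) :
    outVal (labels H r emb ν₀) = H.val ν₀ := by
  rw [outVal_eq, val_eq_sum_coef_smul_baseVal hemb ν₀ (H.rank ν₀) ν₀ rfl (by omega) (Fin.last r)
    (by simp [h])]
  rfl

end Embedding

/-! ### Prop. 3.3 (2): every degree-`r` form of small complexity is an output of the universal circuit -/

section Complexity

open DepthReduction

variable {σ : Type v} [Fintype σ] [DecidableEq σ] {r N : ℕ}

/-- **Raz 2010, Prop. 3.3 (2)** (with Prop. 2.3/2.8: homogenisation and embedding), in the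
tree's circuit model: a homogeneous polynomial `g ∈ R[Z]` of degree `r ≥ 1` computed by a
fan-in-two circuit with at most `s` gates is the output `OUT(y)` of the universal
circuit-graph with `N ≥ 4 s (r+1)²` slots, for a suitable labelling `y` of its edges. (The
straight-line program of the circuit is homogenised by `SLP.homogenize`, a homogeneous
circuit on `≤ 4 s (r+1)²` nodes whose node `(i, Q r)` computes the degree-`r` component of
line `i`, and then embedded by `outVal_labels`.) [cite: Raz2010, Prop. 3.3 (p. 158), Prop. 2.8, Prop. 2.3] -/
theorem exists_labels_of_complexity_le {s : ℕ} (hr : 1 ≤ r) (hN : 4 * s * (r + 1) ^ 2 ≤ N)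
    {g : MvPolynomial σ R} (hg : g.IsHomogeneous r) (hc : complexity g ≤ s) :
    ∃ y : Lab σ r N → R, outVal y = g := by
  classical
  rcases subsingleton_or_nontrivial R with hR | hR
  · exact ⟨fun _ => 0, MvPolynomial.ext _ _ fun m => Subsingleton.elim _ _⟩
  obtain ⟨P, hP2, hPg, hPs⟩ := ArithCircuit.exists_computes_size_eq_complexity g
  obtain ⟨S, hlen, hcases⟩ := exists_slp P hP2
  have hPg' : P.eval = g := hPg
  rcases hcases with ⟨i, hi, hgi⟩ | ⟨j, hgj⟩ | ⟨c, hgc⟩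
  · -- the generic case: `g` is the value of line `i`
    have hcard : Fintype.card (S.Node r) ≤ N :=
      (S.card_node_le r).trans ((Nat.mul_le_mul_right _ (Nat.mul_le_mul_left 4
        (by rw [hlen, hPs]; exact hc))).trans hN)
    let emb : S.Node r → Fin N := fun ν => Fin.castLE hcard (Fintype.equivFin _ ν)
    have hemb : Function.Injective emb := fun ν μ h =>
      (Fintype.equivFin _).injective (Fin.castLE_injective hcard h)
    let ν₀ : S.Node r := (⟨i, hi⟩, SLP.Tag.Q ⟨r, Nat.lt_succ_self r⟩)
    refine ⟨labels (S.homogenize r) r emb ν₀, ?_⟩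
    rw [outVal_labels (H := S.homogenize r) hemb hr rfl]
    show homogeneousComponent r (S.val i) = g
    rw [← hgi, hPg', homogeneousComponent_of_mem hg, if_pos rfl]
  · -- `g = z_j`: then `r = 1` and the output gate reads the leaf `z_j`
    rw [hPg'] at hgj
    subst hgj
    have hr1 : r = 1 := (hg.inj_right (isHomogeneous_X R j) (X_ne_zero j))
    subst hr1
    refine ⟨Sum.elim (fun _ => 0) (Pi.single (Sum.inl j) 1), ?_⟩
    rw [outVal_eq]
    simp only [Sum.elim_inr]
    rw [sum_single_one_smul, baseVal_inl, if_pos (by simp)]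
  · -- `g = C c`: then `g = 0`
    rw [hPg'] at hgc
    subst hgc
    have h0 : C c = (0 : MvPolynomial σ R) := by
      by_contra hne
      have := hg.inj_right (isHomogeneous_C σ c) hne
      omega
    refine ⟨fun _ => 0, ?_⟩
    rw [outVal_zero, h0]

/-- **Coefficient form** (Raz 2010, Prop. 3.3 (2): "`H(g) ∈ Image(Γ_G)`"): under the same
hypotheses the coefficient vector of `g` is a value of Raz's polynomial mapping `Γ`,
`coeff_e g = (Γ_G)_e (y)` for every monomial `e`. [cite: Raz2010, Prop. 3.3 (p. 158)] -/
theorem exists_eval_uCoeff_eq_coeff {s : ℕ} (hr : 1 ≤ r) (hN : 4 * s * (r + 1) ^ 2 ≤ N)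
    {g : MvPolynomial σ R} (hg : g.IsHomogeneous r) (hc : complexity g ≤ s) :
    ∃ y : Lab σ r N → R, ∀ e, eval y (uCoeff R σ r N e) = coeff e g := by
  obtain ⟨y, hy⟩ := exists_labels_of_complexity_le hr hN hg hc
  exact ⟨y, fun e => by rw [← coeff_outVal, hy]⟩

end Complexity

/-! ### The number of labels -/

section Card

variable (σ : Type v) [Fintype σ] (r N : ℕ)

/-- The number of edge labels of the universal circuit-graph:
`#Y = 2 (r+1) r N (#σ + r N) + (#σ + r N)`. [cite: Raz2010, Prop. 2.8 (p. 155)] -/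
theorem card_lab :
    Fintype.card (Lab σ r N) =
      (r + 1) * (r * (N * (2 * (Fintype.card σ + r * N)))) + (Fintype.card σ + r * N) := by
  simp only [Lab, BIdx, Fintype.card_sum, Fintype.card_prod, Fintype.card_fin, Fintype.card_bool]

/-- A polynomial bound on the number of labels (Raz: `S(G) ≤ Size(G) = O(s'² r⁸)`; here only
"polynomial in `#σ, r, N`" is recorded): `#Y ≤ 3 (#σ + r + N + 1)⁵`.
[cite: Raz2010, Prop. 3.3 (p. 158)] -/
theorem card_lab_le :
    Fintype.card (Lab σ r N) ≤ 3 * (Fintype.card σ + r + N + 1) ^ 5 := by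
  rw [card_lab]
  set B := Fintype.card σ + r + N + 1 with hB
  have h1 : r + 1 ≤ B := by omega
  have h2 : r ≤ B := by omega
  have h3 : N ≤ B := by omega
  have h4 : Fintype.card σ + r * N ≤ B * B := by nlinarith
  have h5 : B * B ≤ B ^ 5 := by
    calc B * B = B ^ 2 := (pow_two B).symm
      _ ≤ B ^ 5 := Nat.pow_le_pow_right (by omega) (by norm_num)
  calc (r + 1) * (r * (N * (2 * (Fintype.card σ + r * N)))) + (Fintype.card σ + r * N)
      ≤ B * (B * (B * (2 * (B * B)))) + B * B := by gcongr
    _ = 2 * B ^ 5 + B * B := by ring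
    _ ≤ 2 * B ^ 5 + B ^ 5 := by omega
    _ = 3 * B ^ 5 := by ring

end Card

end RazUniversal

end Literature.Computability.AlgebraicComplexity
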